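import Mathlib
import Summits.CriticalPhenomena.SAWScalingLimit.Theorems.SAWDefectDecoherenceSectorSlavingDefs
import Summits.CriticalPhenomena.SAWScalingLimit.Theorems.SAWDefectDecoherenceDefectDecoherenceTmStarSums
import Summits.CriticalPhenomena.SAWScalingLimit.Theorems.SAWDefectDecoherenceSpinShift
import Literature.Probability.RandomPlanarGeometry.HexParafermionSpinShift
import HarnessLib

/-!
# Tip regrouping, auxiliary file 1: lifted arrival direction and the geometry of a star
(helpers for the stub `stub_tipRegrouping` of the line `sector-slaving`, crux `DefectDecoherence`,
stmt-CriticalPhenomena-8549)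

* `tip_exp_lifted_direction`: for a walk `γ : s(u,w) → s(y,z)` of `Λ` (`u ∉ Λ`, `u ∼ w`, `y ∼ z`)
  with last vertex `y`, the LIFTED arrival angle `Θ = θ_a + W(γ)` (`θ_a = rootAngle u w`)
  satisfies `e^{iΘ} = dartUnit z y = (c_z - c_y)/‖c_z - c_y‖`: the unit tangent telescopes along
  the embedded polyline (`SpinShift.exp_winding_mul_I_mul_unit`).
* `tip_star_eq`: the star of `v` (all three neighbours in `Λ`) is `{s, ρ s, ρ² s}` for any
  neighbour `s`, `ρ = rot3 v` the rotation by `120°` about `c_v`; the two other darts out of `v`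
  are `c_{ρ s} - c_v = e^{-iπ/3}(c_v - c_s)`, `c_{ρ² s} - c_v = e^{iπ/3}(c_v - c_s)`
  (`tip_hexCenter_rot3_sub`, `tip_hexCenter_rot3_rot3_sub`), so the turn at `v` of a walk
  `… → s → v → mid{v,t}` is `∓π/3` (`tip_turning_rot3`, `tip_turning_rot3_rot3`).
* `tip_winding_snoc`: appending the vertex `v` to a walk ending at `s` on the mid-edge `{s,v}` adds
  exactly the turning angle at `c_v` (the old last half-segment is collinear with `c_s → c_v`).

Sources: H. Duminil-Copin, S. Smirnov, Ann. of Math. 175 (2012) (arXiv:1007.0575), §2 (windings,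
proof of Lemma 1); the line card `Lines/sector-slaving.md`.
-/

noncomputable section

open scoped BigOperators ComplexConjugate Classical
open Literature.Probability.LatticeModels Literature.Probability.RandomPlanarGeometry.SAW
open Summit.CriticalPhenomena.SAWScalingLimit.Theorems.DefectDecoherence.TipMartingale
open Summit.CriticalPhenomena.SAWScalingLimit.Theorems.SpinShift

namespace Summit.CriticalPhenomena.SAWScalingLimit.Theorems.DefectDecoherence.SectorSlaving

/-! ### The lifted arrival direction -/

/-- The unit vector of the root dart: `e^{iθ_a} = (c_w - c_u)/‖c_w - c_u‖`. [folklore] -/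
theorem tip_exp_rootAngle {u w : HexVertex} (huw : hexGraph.Adj u w) :
    Complex.exp ((rootAngle u w : ℂ) * Complex.I) =
      (hexCenter w - hexCenter u) / ((‖hexCenter w - hexCenter u‖ : ℝ) : ℂ) := by
  have h0 : hexCenter w - hexCenter u ≠ 0 := hexCenter_sub_ne_zero_of_adj huw
  have hn : ((‖hexCenter w - hexCenter u‖ : ℝ) : ℂ) ≠ 0 := by exact_mod_cast norm_ne_zero_iff.2 h0
  rw [rootAngle, eq_div_iff hn, mul_comm]
  exact Complex.norm_mul_exp_arg_mul_I _

/-- **Lifted arrival direction.** For a walk `γ` from the boundary mid-edge `s(u,w)` (`u ∉ Λ`,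
`u ∼ w`) to the mid-edge `s(y,z)` (`y ∼ z`) whose last vertex is `y`, the lifted arrival angle
`Θ = θ_a + W(γ)` has `e^{iΘ}` equal to the unit vector of the final dart `y → z`:
the unit tangent telescopes from the first half-edge `(c_w - c_u)/2` to the last one
`(c_z - c_y)/2`. [folklore] -/
theorem tip_exp_lifted_direction {Λ : Finset HexVertex} {u w y z : HexVertex}
    (huw : hexGraph.Adj u w) (hu : u ∉ Λ) (hyz : hexGraph.Adj y z)
    (γ : HexMidEdgeSAW Λ s(u, w) s(y, z)) (hy : γ.verts.getLast? = some y) :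
    Complex.exp (((rootAngle u w + γ.winding : ℝ) : ℂ) * Complex.I) = dartUnit z y := by
  have hne : γ.verts ≠ [] := by rintro h; simp [h] at hy
  obtain ⟨w₁, rest, hrest⟩ := List.exists_cons_of_ne_nil hne
  have hw₁ : w₁ = w := by
    have h := γ.head_mem w₁ (by rw [hrest]; rfl)
    rcases Sym2.mem_iff.1 h with rfl | h
    · exact absurd (γ.subset _ (by rw [hrest]; exact List.mem_cons_self)) hu
    · exact h
  subst hw₁
  obtain ⟨init, hinit⟩ : ∃ init, γ.verts = init ++ [y] :=
    ⟨γ.verts.dropLast, (List.dropLast_append_getLast? y hy).symm⟩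
  set D₁ : ℂ := hexCenter w₁ - hexCenter u with hD₁
  set D₂ : ℂ := hexCenter z - hexCenter y with hD₂
  have hD₁0 : D₁ ≠ 0 := hexCenter_sub_ne_zero_of_adj huw
  have hD₂0 : D₂ ≠ 0 := hexCenter_sub_ne_zero_of_adj hyz
  have e₁ : hexCenter w₁ - hexMidpoint s(u, w₁) = D₁ / 2 := by
    rw [hexMidpoint_mk, hD₁]; ring
  have e₂ : hexMidpoint s(y, z) - hexCenter y = D₂ / 2 := by
    rw [hexMidpoint_mk, hD₂]; ring
  -- the polyline, written from both ends
  have hp1 : γ.points = hexMidpoint s(u, w₁) :: hexCenter w₁ ::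
      (rest.map hexCenter ++ [hexMidpoint s(y, z)]) := by
    simp [HexMidEdgeSAW.points, hrest]
  have hp2 : (hexMidpoint s(u, w₁) :: init.map hexCenter) ++ [hexCenter y, hexMidpoint s(y, z)] =
      γ.points := by
    simp [HexMidEdgeSAW.points, hinit, List.map_append, List.append_assoc]
  -- consecutive points are distinct
  have hch0 : List.IsChain (· ≠ ·) (γ.verts.map hexCenter) :=
    List.isChain_map_of_isChain hexCenter
      (fun a b hab => (sub_ne_zero.1 (hexCenter_sub_ne_zero_of_adj hab)).symm) γ.isChain
  have hch1 : List.IsChain (· ≠ ·) (hexMidpoint s(u, w₁) :: γ.verts.map hexCenter) := by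
    rw [hrest, List.map_cons, List.isChain_cons_cons]
    refine ⟨?_, by rw [← List.map_cons, ← hrest]; exact hch0⟩
    intro h
    apply hD₁0
    have h' : hexCenter w₁ - hexMidpoint s(u, w₁) = 0 := by rw [h, sub_self]
    rw [e₁] at h'
    simpa using h'
  have hch : List.IsChain (· ≠ ·)
      ((hexMidpoint s(u, w₁) :: init.map hexCenter) ++ [hexCenter y, hexMidpoint s(y, z)]) := by
    rw [List.isChain_append_cons_cons]
    refine ⟨?_, ?_, List.isChain_singleton _⟩
    · have e : (hexMidpoint s(u, w₁) :: init.map hexCenter) ++ [hexCenter y] =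
          hexMidpoint s(u, w₁) :: γ.verts.map hexCenter := by
        rw [hinit, List.map_append, List.map_cons, List.map_nil, List.cons_append]
      rw [e]
      exact hch1
    · intro h
      apply hD₂0
      have h' : hexMidpoint s(y, z) - hexCenter y = 0 := by rw [h, sub_self]
      rw [e₂] at h'
      simpa using h'
  -- telescope
  have key := exp_winding_mul_I_mul_unit (rest.map hexCenter ++ [hexMidpoint s(y, z)])
    (hexMidpoint s(u, w₁)) (hexCenter w₁) (hexMidpoint s(u, w₁) :: init.map hexCenter)
    (hexCenter y) (hexMidpoint s(y, z)) (hp2.trans hp1) (by rw [← hp1, ← hp2]; exact hch)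
  rw [← hp1] at key
  change Complex.exp ((γ.winding : ℂ) * Complex.I) * _ = _ at key
  rw [e₁, e₂] at key
  have hn₁ : ((‖D₁‖ : ℝ) : ℂ) ≠ 0 := by exact_mod_cast norm_ne_zero_iff.2 hD₁0
  have hn₂ : ((‖D₂‖ : ℝ) : ℂ) ≠ 0 := by exact_mod_cast norm_ne_zero_iff.2 hD₂0
  have hu₁ : D₁ / 2 / ((‖D₁ / 2‖ : ℝ) : ℂ) = D₁ / ((‖D₁‖ : ℝ) : ℂ) := by
    rw [norm_div]
    simp only [RCLike.norm_ofNat, Complex.ofReal_div, Complex.ofReal_ofNat]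
    field_simp
  have hu₂ : D₂ / 2 / ((‖D₂ / 2‖ : ℝ) : ℂ) = D₂ / ((‖D₂‖ : ℝ) : ℂ) := by
    rw [norm_div]
    simp only [RCLike.norm_ofNat, Complex.ofReal_div, Complex.ofReal_ofNat]
    field_simp
  rw [hu₁, hu₂] at key
  rw [Complex.ofReal_add, add_mul, Complex.exp_add, tip_exp_rootAngle huw, mul_comm]
  exact key

/-- The lifted direction, multiplicative form: `c_z - c_y = ‖c_z - c_y‖ · e^{iΘ}`. [folklore] -/
theorem tip_hexCenter_sub_eq_norm_mul_exp {Λ : Finset HexVertex} {u w y z : HexVertex}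
    (huw : hexGraph.Adj u w) (hu : u ∉ Λ) (hyz : hexGraph.Adj y z)
    (γ : HexMidEdgeSAW Λ s(u, w) s(y, z)) (hy : γ.verts.getLast? = some y) :
    hexCenter z - hexCenter y = ((‖hexCenter z - hexCenter y‖ : ℝ) : ℂ) *
      Complex.exp (((rootAngle u w + γ.winding : ℝ) : ℂ) * Complex.I) := by
  rw [tip_exp_lifted_direction huw hu hyz γ hy, dartUnit]
  have hn : ((‖hexCenter z - hexCenter y‖ : ℝ) : ℂ) ≠ 0 := by
    exact_mod_cast norm_ne_zero_iff.2 (hexCenter_sub_ne_zero_of_adj hyz)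
  field_simp

/-! ### The star of a vertex: `{s, ρ s, ρ² s}` -/

/-- `e^{-iπ/3} = 1 - ζ = -ζ²`. [folklore] -/
theorem tip_exp_neg_pi_div_three :
    Complex.exp (((-(Real.pi / 3) : ℝ) : ℂ) * Complex.I) = -triZeta ^ 2 := by
  rw [triZeta_sq]
  apply Complex.ext
  · rw [Complex.exp_ofReal_mul_I_re, Real.cos_neg, Real.cos_pi_div_three]
    norm_num
  · rw [Complex.exp_ofReal_mul_I_im, Real.sin_neg, Real.sin_pi_div_three]
    simp

/-- `e^{iπ/3} = ζ = -ζ⁴`. [folklore] -/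
theorem tip_exp_pi_div_three :
    Complex.exp (((Real.pi / 3 : ℝ) : ℂ) * Complex.I) = -triZeta ^ 4 := by
  have h4 : -triZeta ^ 4 = triZeta := by
    have : triZeta ^ 4 = (triZeta ^ 2) ^ 2 := by ring
    rw [this, triZeta_sq]
    linear_combination (-1 : ℂ) * triZeta_sq
  rw [h4, triZeta]
  congr 1
  push_cast
  ring

/-- The dart `v → ρ s` is the dart `s → v` turned by `-π/3`:
`c_{ρ s} - c_v = e^{-iπ/3} (c_v - c_s)`. [folklore] -/
theorem tip_hexCenter_rot3_sub (v s : HexVertex) :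
    hexCenter (rot3 v s) - hexCenter v =
      Complex.exp (((-(Real.pi / 3) : ℝ) : ℂ) * Complex.I) * (hexCenter v - hexCenter s) := by
  rw [tip_exp_neg_pi_div_three, hexCenter_rot3_sub]
  ring

/-- The dart `v → ρ² s` is the dart `s → v` turned by `+π/3`:
`c_{ρ² s} - c_v = e^{iπ/3} (c_v - c_s)`. [folklore] -/
theorem tip_hexCenter_rot3_rot3_sub (v s : HexVertex) :
    hexCenter (rot3 v (rot3 v s)) - hexCenter v =
      Complex.exp (((Real.pi / 3 : ℝ) : ℂ) * Complex.I) * (hexCenter v - hexCenter s) := by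
  rw [tip_exp_pi_div_three, hexCenter_rot3_sub,
    show hexCenter (rot3 v s) - hexCenter v = triZeta ^ 2 * (hexCenter s - hexCenter v) from
      hexCenter_rot3_sub v s]
  ring

/-- The three vertices `s, ρ s, ρ² s` are pairwise distinct as soon as `s ≠ v`
(here: `s ∼ v`). [folklore] -/
theorem tip_rot3_ne {v s : HexVertex} (hs : hexGraph.Adj v s) :
    s ≠ rot3 v s ∧ s ≠ rot3 v (rot3 v s) ∧ rot3 v s ≠ rot3 v (rot3 v s) := by
  have h0 : hexCenter s - hexCenter v ≠ 0 := hexCenter_sub_ne_zero_of_adj hs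
  have h1 := hexCenter_rot3_sub v s
  have h2 : hexCenter (rot3 v (rot3 v s)) - hexCenter v =
      triZeta ^ 4 * (hexCenter s - hexCenter v) := by
    rw [hexCenter_rot3_sub, h1]; ring
  have hz2 : triZeta ^ 2 ≠ 1 := by
    intro h
    have := congrArg Complex.re h
    rw [triZeta_sq, Complex.sub_re, triZeta_re] at this
    norm_num at this
  have hz4 : triZeta ^ 4 ≠ 1 := by
    intro h
    have e : triZeta ^ 4 = -triZeta := by
      have : triZeta ^ 4 = (triZeta ^ 2) ^ 2 := by ring
      rw [this, triZeta_sq]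
      linear_combination triZeta_sq
    rw [e] at h
    have := congrArg Complex.re h
    rw [Complex.neg_re, triZeta_re] at this
    norm_num at this
  have hz24 : triZeta ^ 2 ≠ triZeta ^ 4 := by
    intro h
    have e : triZeta ^ 4 = -triZeta := by
      have : triZeta ^ 4 = (triZeta ^ 2) ^ 2 := by ring
      rw [this, triZeta_sq]
      linear_combination triZeta_sq
    rw [e, triZeta_sq] at h
    have := congrArg Complex.im h
    rw [Complex.sub_im, Complex.neg_im, triZeta_im] at this
    have h3 : (0 : ℝ) < Real.sqrt 3 := Real.sqrt_pos.2 (by norm_num)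
    norm_num at this
    linarith
  refine ⟨fun h => hz2 ?_, fun h => hz4 ?_, fun h => hz24 ?_⟩
  · have e := h1
    rw [← h] at e
    exact (mul_eq_right₀ h0).1 e.symm ▸ rfl
  · have e := h2
    rw [← h] at e
    exact (mul_eq_right₀ h0).1 e.symm ▸ rfl
  · have e := h2
    rw [← h, h1] at e
    exact mul_right_cancel₀ h0 e

/-- **The neighbours of `v` are `s, ρ s, ρ² s`** for any neighbour `s` (`ρ = rot3 v` is a lattice
automorphism fixing `v`, and `v` has exactly three neighbours). [folklore] -/
theorem tip_adj_iff {v s : HexVertex} (hs : hexGraph.Adj v s) (t : HexVertex) :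
    hexGraph.Adj v t ↔ t = s ∨ t = rot3 v s ∨ t = rot3 v (rot3 v s) := by
  have hr : ∀ y, hexGraph.Adj v y → hexGraph.Adj v (rot3 v y) := fun y hy => by
    have h := (rot3_adj_iff v v y).2 hy
    rwa [rot3_self] at h
  have h1 : hexGraph.Adj v (rot3 v s) := hr s hs
  have h2 : hexGraph.Adj v (rot3 v (rot3 v s)) := hr _ h1
  obtain ⟨n1, n2, n3⟩ := tip_rot3_ne hs
  constructor
  · intro ht
    have hsub : (({s, rot3 v s, rot3 v (rot3 v s)} : Finset HexVertex) : Set HexVertex) ⊆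
        hexGraph.neighborSet v := by
      intro x hx
      simp only [Finset.coe_insert, Finset.coe_singleton, Set.mem_insert_iff,
        Set.mem_singleton_iff] at hx
      rcases hx with rfl | rfl | rfl
      · exact hs
      · exact h1
      · exact h2
    have hcard : (hexGraph.neighborSet v).ncard = 3 := card_neighborSet_hexGraph_holds v
    have hcard' : (({s, rot3 v s, rot3 v (rot3 v s)} : Finset HexVertex) : Set HexVertex).ncard
        = 3 := by
      rw [Set.ncard_coe_finset, Finset.card_insert_of_notMem, Finset.card_pair n3]
      simp only [Finset.mem_insert, Finset.mem_singleton, not_or]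
      exact ⟨n1, n2⟩
    have heq := Set.eq_of_subset_of_ncard_le hsub (by rw [hcard, hcard'])
      (Set.finite_of_ncard_ne_zero (by rw [hcard]; norm_num))
    have htm : t ∈ hexGraph.neighborSet v := ht
    rw [← heq] at htm
    simpa using htm
  · rintro (rfl | rfl | rfl)
    · exact hs
    · exact h1
    · exact h2

/-- **The star of a vertex all of whose neighbours lie in `Λ`** is `{s, ρ s, ρ² s}`. [folklore] -/
theorem tip_star_eq {Λ : Finset HexVertex} {v s : HexVertex} (hs : hexGraph.Adj v s)
    (hΛ : ∀ t, hexGraph.Adj v t → t ∈ Λ) :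
    star Λ v = {s, rot3 v s, rot3 v (rot3 v s)} := by
  ext t
  simp only [TipMartingale.star, Finset.mem_filter, Finset.mem_insert, Finset.mem_singleton]
  rw [← tip_adj_iff hs t]
  exact ⟨fun h => h.2, fun h => ⟨hΛ t h, h⟩⟩

/-- Summing over the star with the dart of `s` removed: the two other neighbours. [folklore] -/
theorem tip_sum_star_ite {M : Type*} [AddCommMonoid M] {Λ : Finset HexVertex} {v s : HexVertex}
    (hs : hexGraph.Adj v s) (hΛ : ∀ t, hexGraph.Adj v t → t ∈ Λ) (g : HexVertex → M) :
    ∑ t ∈ star Λ v, (if s = t then 0 else g t) = g (rot3 v s) + g (rot3 v (rot3 v s)) := by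
  obtain ⟨n1, n2, n3⟩ := tip_rot3_ne hs
  rw [tip_star_eq hs hΛ, Finset.sum_insert (by simp [n1, n2]), Finset.sum_pair n3, if_pos rfl,
    if_neg n1, if_neg n2, zero_add]

/-! ### Turning angles at `v` -/

/-- The turn at `v` of `s → v → mid{v, ρ s}` is `-π/3`. [folklore] -/
theorem tip_turning_rot3 {v s : HexVertex} (hs : hexGraph.Adj v s) :
    turning (hexCenter s) (hexCenter v) (hexMidpoint s(rot3 v s, v)) = -(Real.pi / 3) := by
  have h0 : hexCenter v - hexCenter s ≠ 0 := hexCenter_sub_ne_zero_of_adj hs.symm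
  have e : hexMidpoint s(rot3 v s, v) - hexCenter v =
      ((1 / 2 : ℝ) : ℂ) * (Complex.exp (((-(Real.pi / 3) : ℝ) : ℂ) * Complex.I) *
        (hexCenter v - hexCenter s)) := by
    rw [← tip_hexCenter_rot3_sub, hexMidpoint_mk]; push_cast; ring
  rw [turning, e, mul_div_assoc, mul_div_cancel_right₀ _ h0, Complex.arg_real_mul _ (by norm_num),
    Complex.arg_exp_mul_I, toIocMod_eq_self]
  constructor <;> linarith [Real.pi_pos]

/-- The turn at `v` of `s → v → mid{v, ρ² s}` is `+π/3`. [folklore] -/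
theorem tip_turning_rot3_rot3 {v s : HexVertex} (hs : hexGraph.Adj v s) :
    turning (hexCenter s) (hexCenter v) (hexMidpoint s(rot3 v (rot3 v s), v)) = Real.pi / 3 := by
  have h0 : hexCenter v - hexCenter s ≠ 0 := hexCenter_sub_ne_zero_of_adj hs.symm
  have e : hexMidpoint s(rot3 v (rot3 v s), v) - hexCenter v =
      ((1 / 2 : ℝ) : ℂ) * (Complex.exp (((Real.pi / 3 : ℝ) : ℂ) * Complex.I) *
        (hexCenter v - hexCenter s)) := by
    rw [← tip_hexCenter_rot3_rot3_sub, hexMidpoint_mk]; push_cast; ring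
  rw [turning, e, mul_div_assoc, mul_div_cancel_right₀ _ h0, Complex.arg_real_mul _ (by norm_num),
    Complex.arg_exp_mul_I, toIocMod_eq_self]
  constructor <;> linarith [Real.pi_pos]

/-! ### Winding of a walk prolonged by one vertex -/

/-- **Appending a vertex adds one turning angle.** The polyline of a walk `… → s` ending on the
mid-edge `{s, v}` and that of its prolongation `… → s → v` ending at a point `m` differ by the
turn at `c_v` only: the old last half-segment `c_s → mid{s,v}` is the first half of the new
segment `c_s → c_v` (no turn at `mid{s,v}`). [folklore] -/
theorem tip_winding_snoc (p : ℂ) (L : List HexVertex) (s v : HexVertex) (m : ℂ) :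
    winding (p :: (L ++ [s] ++ [v]).map hexCenter ++ [m]) =
      winding (p :: (L ++ [s]).map hexCenter ++ [hexMidpoint s(s, v)]) +
        turning (hexCenter s) (hexCenter v) m := by
  have hm : hexMidpoint s(s, v) = hexCenter s + (1 / 2 : ℝ) * (hexCenter v - hexCenter s) := by
    rw [hexMidpoint_mk]; push_cast; ring
  have h1 := winding_concat₃ (p :: L.map hexCenter) (hexCenter s) (hexCenter v) m
  have h2 := winding_concat_right_ray (t := 1 / 2) (by norm_num) (p :: L.map hexCenter)
    (hexCenter s) (hexCenter v)
  rw [← hm] at h2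
  simp only [List.map_append, List.map_cons, List.map_nil, List.cons_append, List.append_assoc,
    List.nil_append] at h1 h2 ⊢
  rw [h1, h2]

/-! ### Registered helper -/

/-- **Registered helper `tip_lifted_direction`** (the lifted arrival direction `e^{iΘ}` of a walk
from the root dart `u → w` is the unit vector of its final dart). [folklore] -/
theorem tip_lifted_direction : ∀ (Λ : Finset HexVertex) (u w y z : HexVertex),
    hexGraph.Adj u w → u ∉ Λ → hexGraph.Adj y z →
      ∀ γ : HexMidEdgeSAW Λ s(u, w) s(y, z), γ.verts.getLast? = some y →
        Complex.exp (((rootAngle u w + γ.winding : ℝ) : ℂ) * Complex.I) = dartUnit z y :=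
  fun _ _ _ _ _ huw hu hyz γ hy => tip_exp_lifted_direction huw hu hyz γ hy

end Summit.CriticalPhenomena.SAWScalingLimit.Theorems.DefectDecoherence.SectorSlaving

end
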